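import Summits.QuantumFields.BalabanUV.T4Continuum.Support.NE7CurvedLiftBookkeeping
import HarnessLib

/-!
# NE7CurvedLiftBookkeepingTwoTerm — THE ROOT OF THE CURVED (APE) RE-CUT AFTER THE OBSTRUCTION F128: (i) the letters (hNorth, hEXP, hWten, hcrit, hTT) ALONE give the SLICE
# FUNCTIONAL BOUND `|hess_W(A − A_N, Y)| ≤ (τ + ρ + κ)‖Y‖_{ℓ¹}` on `W`-tangent `Y` (F55's internal step, now EXPORTED); (ii) a curl bound `c_X` for the ONE field `X = A − A_N` gives
# `SmallField (We^{A}) (x + c_X + c_N + 28α₀²)`; (iii) hence F55 with the slice-solver letter in the TWO-TERM shape `‖curlAt W X‖ ≤ K_G·g + E_G` (the only shape that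
# survives at curved `W`, F128∕F129): `SmallField (We^{A}) (x + (K_G(τ + ρ + κ) + E_G + c_N + 28α₀²))` (file 61 of the curved (APE))

Cell `pub-balaban`, rung (B)+1 sub-cell t4, lineage `b2b-balaban-t4-ne7-p1` (CRUX PROVER NE7 #1 = OWNER of row NE7), generation 80; memo
`t4/b2b-balaban-t4-ne7-p1-g80/SLICE-LETTER-OBSTRUCTION.md` §3.  File F131, over F55 `NE7CurvedLiftBookkeeping` (`norm_hol_vary_sub_one_le_of_curl_W`; the proof of
`smallField_vary_of_curvedLetters` re-cut), row NE3's `NE3ResidualSliceRep.dirIter_sub`, `NE3EnergyHessBilin.hess_add_left ∕ curlAt_add`, `NE7ExactCurrent.dAction_add`.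
WHY.  F55 … F123d carry the slice-solver letter (L2) as the schema `hG : ∀ X ∈ S … (functional ≤ g) → ‖curlAt W X‖ ≤ K_G·g`; F112 … F123d add `hS : S ⊇ {W-tangent skew periodic}`.
F128∕F129∕F130 (this generation) prove that pair UNSATISFIABLE at admissible curved backgrounds (constant abelian flux): a residual gauge mode has zero slice functional and
non-zero curl.  Two facts survive: F55 applies `hG` exactly ONCE, to `X = A − A_N` with `g = τ + ρ + κ`; and the true curved statement must allow a `g`-INDEPENDENT term (F128
`twoTerm_allowance_ge`: at least the plaquette commutator of the gauge content of `S`).  THIS FILE re-cuts the root accordingly, so that the successor re-threads F57 → F123d with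
`E_G` carried next to `c_N` (memo §3: one token per file), or docks a field-specific slice bound directly through §2.
WHAT ([folklore]; 0 def, 0 sorry).  §1 **`hess_functional_of_curvedLetters`** — hNorth + hEXP + hWten + hcrit + hTT ⟹ `∀ Y` skew periodic `W`-tangent,
`|hess W (A − A_N) Y (perWin d P)| ≤ (τ + ρ + κ)·dirL1 Y (periodBox P)`, and `A − A_N` is periodic and `W`-tangent; §2 **`smallField_vary_of_curl`** — hN7 + a curl bound `c_X` on
`A − A_N` ⟹ `SmallField (vary W A 1) (x + (c_X + c_N + 28α₀²))`; §3 **`smallField_vary_of_curvedLetters_twoTerm`** — F55 with `hG` two-term (`… ≤ K_G·g + E_G`), conclusion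
`x + (K_G(τ + ρ + κ) + E_G + c_N + 28α₀²)` (at `E_G = 0` this is literally F55's `smallField_vary_of_curvedLetters` — the gate's dedup check confirms it — so the re-cut loses nothing).
HONEST FRAMING (page 1): bookkeeping over DISPLAYED letters at one configuration; the two-term letter is a HYPOTHESIS SHAPE (its provider is Bałaban's background-field propagator
theory on the gauge-fixed slice, [Balaban1985PropagatorsII]∕B9 material — NOT in the tree at curved `W`); nothing of Bałaban's asserted; (APE) on curved data NOT proved; NOT
ONE-STEP, NOT NE7; spine 0∕9; finite T⁴ rung (B)+1 — NOT infinite volume, NOT mass gap, NOT `BetaPertH`, NOT Clay.  Continuum YM on T⁴ ⇐ BetaPertH ∧ nine spine estimates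
(0/9 proved); BetaPertH ⇐ (D1) ∧ (D4) ∧ CAP+tail; G-an2-4 gates asym, D1 and NE2/3/4.
-/

set_option autoImplicit false

open scoped BigOperators Matrix Matrix.Norms.L2Operator
open NormedSpace Finset Set

namespace Summit.QuantumFields.BalabanUV.T4Continuum.NE7CurvedLiftBookkeepingTwoTerm

open Literature.MathematicalPhysics.QuantumFieldTheory.Balaban1983to89
open B7Prop1Explicit B7Prop2Explicit MatrixLog UnitaryModel
open T4AveragingDeficitWall (IsUnitaryCfg IsSkewDir SmallField vary curlAt dirL1 vary_zero)
open T4AveragingDeficitWallBoundary (IsPeriodicCfg periodBox)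
open AveragingDeficitPeriodicCounting (IsPeriodicDir)
open AveragingDeficitMultiLevelPrep (LevelSmall)
open MinimalActionLevels (perWin)
open NE3HessForm (hess dAction)
open NE3TangentCovariantTower (dirIter)
open NE3ResidualSliceRep (dirIter_sub)
open NE3EnergyHessBilin (hess_add_left curlAt_add)
open NE7ExactCurrent (dAction_add)
open NE7CurvedLiftBookkeeping (norm_hol_vary_sub_one_le_of_curl_W)

noncomputable section

variable {d : ℕ} {n : Type*} [Fintype n] [DecidableEq n]

/-! ## §1 The slice functional bound of the expansion field from the letters alone -/

/-- **THE SLICE FUNCTIONAL BOUND OF `X = A − A_N`** from hNorth (exact Hessian orthogonality of the normal part on tangent fields), hEXP (second-order remainder `ρ`), hWten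
(background tension `κ`), hcrit (tangent-criticality of `We^{A}`) and hTT (tangent transport `τ`): for every skew `P`-periodic `W`-tangent `Y`,
`|hess W X Y (perWin d P)| ≤ (τ + ρ + κ)·dirL1 Y (periodBox P)`; moreover `X` is `P`-periodic and `W`-tangent (row NE3's `dirIter_sub`). F55's internal step, exported. [folklore] -/
theorem hess_functional_of_curvedLetters [Nonempty n] {L : ℕ} (hL : 1 ≤ L) (k : ℕ) {P : ℕ}
    {W : Site d → Fin d → (Matrix n n ℂ)ˣ} (hW : IsUnitaryCfg W)
    {x : ℝ} (hx : 0 ≤ x) (hs : LevelSmall d L k x) (hWx : SmallField W x)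
    (A : Site d → Fin d → Matrix n n ℂ) (hAP : IsPeriodicDir A (P : ℤ))
    {AN : Site d → Fin d → Matrix n n ℂ} (hNP : IsPeriodicDir AN (P : ℤ))
    (hNexact : dirIter L (k + 1) W AN = dirIter L (k + 1) W A)
    (hNorth : ∀ Y : Site d → Fin d → Matrix n n ℂ, IsSkewDir Y → IsPeriodicDir Y (P : ℤ) → dirIter L (k + 1) W Y = 0 →
      hess W AN Y (perWin d P) = 0)
    {ρ : ℝ}
    (hEXP : ∀ Y : Site d → Fin d → Matrix n n ℂ, IsSkewDir Y → IsPeriodicDir Y (P : ℤ) →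
      |dAction (vary W A 1) Y (perWin d P) - dAction W Y (perWin d P) - hess W A Y (perWin d P)| ≤ ρ * dirL1 Y (periodBox (d := d) P))
    {κ : ℝ}
    (hWten : ∀ Y : Site d → Fin d → Matrix n n ℂ, IsSkewDir Y → IsPeriodicDir Y (P : ℤ) → dirIter L (k + 1) W Y = 0 →
      |dAction W Y (perWin d P)| ≤ κ * dirL1 Y (periodBox (d := d) P))
    (hcrit : ∀ Y' : Site d → Fin d → Matrix n n ℂ, IsSkewDir Y' → IsPeriodicDir Y' (P : ℤ) → dirIter L (k + 1) (vary W A 1) Y' = 0 →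
      dAction (vary W A 1) Y' (perWin d P) = 0)
    {τ : ℝ}
    (hTT : ∀ Y : Site d → Fin d → Matrix n n ℂ, IsSkewDir Y → IsPeriodicDir Y (P : ℤ) → dirIter L (k + 1) W Y = 0 →
      ∃ Y' : Site d → Fin d → Matrix n n ℂ, IsSkewDir Y' ∧ IsPeriodicDir Y' (P : ℤ) ∧ dirIter L (k + 1) (vary W A 1) Y' = 0 ∧
        |dAction (vary W A 1) (fun y μ => Y' y μ - Y y μ) (perWin d P)| ≤ τ * dirL1 Y (periodBox (d := d) P)) :
    IsPeriodicDir (fun y μ => A y μ - AN y μ) (P : ℤ) ∧ dirIter L (k + 1) W (fun y μ => A y μ - AN y μ) = 0 ∧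
      ∀ Y : Site d → Fin d → Matrix n n ℂ, IsSkewDir Y → IsPeriodicDir Y (P : ℤ) → dirIter L (k + 1) W Y = 0 →
        |hess W (fun y μ => A y μ - AN y μ) Y (perWin d P)| ≤ (τ + ρ + κ) * dirL1 Y (periodBox (d := d) P) := by
  set X : Site d → Fin d → Matrix n n ℂ := fun y μ => A y μ - AN y μ with hXdef
  have hXP : IsPeriodicDir X (P : ℤ) := fun y i μ => by simp only [hXdef, hAP y i μ, hNP y i μ]
  have hXT : dirIter L (k + 1) W X = 0 := by
    rw [hXdef, dirIter_sub hL k hW hx hs hWx A AN, hNexact]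
    funext z κ'
    simp
  refine ⟨hXP, hXT, fun Y hY hYP hYT => ?_⟩
  have hsplitA : A = X + AN := by funext y μ; simp [hXdef]
  have hhess : hess W X Y (perWin d P) = hess W A Y (perWin d P) := by
    have h := hess_add_left W (perWin d P) X AN Y
    rw [← hsplitA, hNorth Y hY hYP hYT, add_zero] at h
    exact h.symm
  obtain ⟨Y', hY's, hY'P, hY'T, hY'd⟩ := hTT Y hY hYP hYT
  have hc := hcrit Y' hY's hY'P hY'T
  have hdec : dAction (vary W A 1) Y (perWin d P)
      = dAction (vary W A 1) Y' (perWin d P) - dAction (vary W A 1) (fun y μ => Y' y μ - Y y μ) (perWin d P) := by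
    have hYsum : Y' = Y + fun y μ => Y' y μ - Y y μ := by funext y μ; simp
    have h := dAction_add (vary W A 1) Y (fun y μ => Y' y μ - Y y μ) (perWin d P)
    rw [← hYsum] at h
    linarith
  have hdA : |dAction (vary W A 1) Y (perWin d P)| ≤ τ * dirL1 Y (periodBox (d := d) P) := by
    rw [hdec, hc, zero_sub, abs_neg]
    exact hY'd
  have hE := hEXP Y hY hYP
  have hK := hWten Y hY hYP hYT
  have htri : |hess W A Y (perWin d P)| ≤ |dAction (vary W A 1) Y (perWin d P)|
      + |dAction (vary W A 1) Y (perWin d P) - dAction W Y (perWin d P) - hess W A Y (perWin d P)| + |dAction W Y (perWin d P)| := by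
    have h := abs_sub_le (hess W A Y (perWin d P)) (dAction (vary W A 1) Y (perWin d P) - dAction W Y (perWin d P)) 0
    have h1 : |hess W A Y (perWin d P) - (dAction (vary W A 1) Y (perWin d P) - dAction W Y (perWin d P))|
        = |dAction (vary W A 1) Y (perWin d P) - dAction W Y (perWin d P) - hess W A Y (perWin d P)| := by
      rw [abs_sub_comm]
    have h2 : |dAction (vary W A 1) Y (perWin d P) - dAction W Y (perWin d P) - 0|
        ≤ |dAction (vary W A 1) Y (perWin d P)| + |dAction W Y (perWin d P)| := by
      rw [sub_zero]; exact abs_sub _ _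
    rw [sub_zero] at h
    linarith
  rw [hhess]
  calc |hess W A Y (perWin d P)|
      ≤ τ * dirL1 Y (periodBox (d := d) P) + ρ * dirL1 Y (periodBox (d := d) P) + κ * dirL1 Y (periodBox (d := d) P) := by linarith
    _ = (τ + ρ + κ) * dirL1 Y (periodBox (d := d) P) := by ring

/-! ## §2 The bootstrap from a curl bound on the one field `A − A_N` -/

/-- **THE BOOTSTRAP FROM A FIELD-SPECIFIC CURL BOUND**: unitary `W` with `SmallField W x`, skew `A` of radius `α₀`, a normal part `A_N` with `‖curlAt W A_N‖ ≤ c_N`, and a curl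
bound `‖curlAt W (A − A_N) z μ ν‖ ≤ c_X` on the planes `μ ≠ ν` ⟹ `SmallField (vary W A 1) (x + (c_X + c_N + 28α₀²))` (F55 §1 pointwise).  This is the form into which ANY
slice-solver statement — one-term, two-term, structured, or a kernel theorem for the specific field — docks. [folklore] -/
theorem smallField_vary_of_curl [Nonempty n] {W : Site d → Fin d → (Matrix n n ℂ)ˣ} (hW : IsUnitaryCfg W) {x : ℝ} (hWx : SmallField W x)
    {A : Site d → Fin d → Matrix n n ℂ} (hA : IsSkewDir A) {α₀ : ℝ} (hAα : ∀ y μ, ‖A y μ‖ ≤ α₀)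
    {AN : Site d → Fin d → Matrix n n ℂ} {cN : ℝ} (hN7 : ∀ z μ ν, μ ≠ ν → ‖curlAt W AN z μ ν‖ ≤ cN)
    {cX : ℝ} (hcurlX : ∀ z μ ν, μ ≠ ν → ‖curlAt W (fun y κ' => A y κ' - AN y κ') z μ ν‖ ≤ cX) :
    SmallField (vary W A 1) (x + (cX + cN + 28 * α₀ ^ 2)) := by
  have hcurlA : ∀ z μ ν, μ ≠ ν → ‖curlAt W A z μ ν‖ ≤ cX + cN := by
    intro z μ ν hμν
    have hsplit : A = (fun y κ' => A y κ' - AN y κ') + AN := by funext y κ'; simp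
    rw [hsplit, curlAt_add]
    exact (norm_add_le _ _).trans (add_le_add (hcurlX z μ ν hμν) (hN7 z μ ν hμν))
  intro z μ ν hμν
  have h := norm_hol_vary_sub_one_le_of_curl_W hW hA hAα z (hWx z μ ν hμν) (hcurlA z μ ν hμν)
  linarith

/-! ## §3 F55 with the two-term slice-solver letter -/

/-- **F55 WITH THE TWO-TERM LETTER** (the shape that survives at curved `W`, F128): F55's hypotheses with `hG`'s conclusion `‖curlAt W X z μ ν‖ ≤ K_G·g` REPLACED by
`‖curlAt W X z μ ν‖ ≤ K_G·g + E_G` (`E_G` a displayed allowance for the gauge content of `S`) ⟹ `SmallField (vary W A 1) (x + (K_G(τ + ρ + κ) + E_G + c_N + 28α₀²))`. [folklore] -/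
theorem smallField_vary_of_curvedLetters_twoTerm [Nonempty n] {L : ℕ} (hL : 1 ≤ L) (k : ℕ) {P : ℕ}
    {W : Site d → Fin d → (Matrix n n ℂ)ˣ} (hW : IsUnitaryCfg W)
    {x : ℝ} (hx : 0 ≤ x) (hs : LevelSmall d L k x) (hWx : SmallField W x)
    {A : Site d → Fin d → Matrix n n ℂ} (hA : IsSkewDir A) (hAP : IsPeriodicDir A (P : ℤ)) {α₀ : ℝ} (hAα : ∀ y μ, ‖A y μ‖ ≤ α₀)
    {AN : Site d → Fin d → Matrix n n ℂ} (hNP : IsPeriodicDir AN (P : ℤ))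
    (hNexact : dirIter L (k + 1) W AN = dirIter L (k + 1) W A)
    {cN : ℝ} (hN7 : ∀ z μ ν, μ ≠ ν → ‖curlAt W AN z μ ν‖ ≤ cN)
    (hNorth : ∀ Y : Site d → Fin d → Matrix n n ℂ, IsSkewDir Y → IsPeriodicDir Y (P : ℤ) → dirIter L (k + 1) W Y = 0 →
      hess W AN Y (perWin d P) = 0)
    (S : Set (Site d → Fin d → Matrix n n ℂ)) (hTS : (fun y μ => A y μ - AN y μ) ∈ S) {KG EG : ℝ}
    (hG : ∀ X ∈ S, IsPeriodicDir X (P : ℤ) → dirIter L (k + 1) W X = 0 → ∀ g : ℝ, 0 ≤ g →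
      (∀ Y : Site d → Fin d → Matrix n n ℂ, IsSkewDir Y → IsPeriodicDir Y (P : ℤ) → dirIter L (k + 1) W Y = 0 →
        |hess W X Y (perWin d P)| ≤ g * dirL1 Y (periodBox (d := d) P)) →
      ∀ z μ ν, μ ≠ ν → ‖curlAt W X z μ ν‖ ≤ KG * g + EG)
    {ρ : ℝ} (hρ : 0 ≤ ρ)
    (hEXP : ∀ Y : Site d → Fin d → Matrix n n ℂ, IsSkewDir Y → IsPeriodicDir Y (P : ℤ) →
      |dAction (vary W A 1) Y (perWin d P) - dAction W Y (perWin d P) - hess W A Y (perWin d P)| ≤ ρ * dirL1 Y (periodBox (d := d) P))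
    {κ : ℝ} (hκ : 0 ≤ κ)
    (hWten : ∀ Y : Site d → Fin d → Matrix n n ℂ, IsSkewDir Y → IsPeriodicDir Y (P : ℤ) → dirIter L (k + 1) W Y = 0 →
      |dAction W Y (perWin d P)| ≤ κ * dirL1 Y (periodBox (d := d) P))
    (hcrit : ∀ Y' : Site d → Fin d → Matrix n n ℂ, IsSkewDir Y' → IsPeriodicDir Y' (P : ℤ) → dirIter L (k + 1) (vary W A 1) Y' = 0 →
      dAction (vary W A 1) Y' (perWin d P) = 0)
    {τ : ℝ} (hτ : 0 ≤ τ)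
    (hTT : ∀ Y : Site d → Fin d → Matrix n n ℂ, IsSkewDir Y → IsPeriodicDir Y (P : ℤ) → dirIter L (k + 1) W Y = 0 →
      ∃ Y' : Site d → Fin d → Matrix n n ℂ, IsSkewDir Y' ∧ IsPeriodicDir Y' (P : ℤ) ∧ dirIter L (k + 1) (vary W A 1) Y' = 0 ∧
        |dAction (vary W A 1) (fun y μ => Y' y μ - Y y μ) (perWin d P)| ≤ τ * dirL1 Y (periodBox (d := d) P)) :
    SmallField (vary W A 1) (x + (KG * (τ + ρ + κ) + EG + cN + 28 * α₀ ^ 2)) := by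
  obtain ⟨hXP, hXT, hsrc⟩ := hess_functional_of_curvedLetters hL k hW hx hs hWx A hAP hNP hNexact hNorth hEXP hWten hcrit hTT
  have hcurlX : ∀ z μ ν, μ ≠ ν → ‖curlAt W (fun y κ' => A y κ' - AN y κ') z μ ν‖ ≤ KG * (τ + ρ + κ) + EG :=
    hG _ hTS hXP hXT (τ + ρ + κ) (add_nonneg (add_nonneg hτ hρ) hκ) hsrc
  have h := smallField_vary_of_curl hW hWx hA hAα hN7 hcurlX
  have heq : x + (KG * (τ + ρ + κ) + EG + cN + 28 * α₀ ^ 2) = x + ((KG * (τ + ρ + κ) + EG) + cN + 28 * α₀ ^ 2) := by ring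
  rw [heq]
  exact h

end

end Summit.QuantumFields.BalabanUV.T4Continuum.NE7CurvedLiftBookkeepingTwoTerm
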